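import Literature.Geometry.GeometricMeasureTheory.RectifiableFrameRank
import Literature.Geometry.GeometricMeasureTheory.RectifiableAdd
import Literature.Geometry.GeometricMeasureTheory.CurrentsProofs

/-!
# Normal form of admissible data; `𝓡_m(V)`, `𝐈_m(V)`, `𝓕_m(V)` are groups; `𝓕` is a metric

For the currents of integration `[W, θ, ξ]` with admissible data (`IsRectifiableData`) of
`Literature.Geometry.GeometricMeasureTheory.Currents`:

* `approxTangentCone_mono` — `Tan^m(μ, a) ⊆ Tan^m(ν, a)` for `μ ≤ ν`;
* `ae_span_eq_approxTangentCone_restrict_of_subset` — **Federer 3.2.19 on sub-carriers**: if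
  `span ξ = Tan^m(𝓗^m ⌞ W, ·)` a.e. on a countably `m`-rectifiable `W`, then
  `span ξ = Tan^m(𝓗^m ⌞ W', ·)` a.e. on every measurable `W' ⊆ W` (Lipschitz parametrisations,
  Rademacher, the tangent-vector theorem `fderiv_apply_mem_posTangentConeAt_ae` of
  `ApproxTangentLipschitz.lean` and Sard's lemma for Lipschitz maps of
  `Literature/Analysis/Calculus/LipschitzSardHausdorff.lean`, dimension count);
* `IsRectifiableData.subset`, `IsRectifiableData.exists_subset_normalized` — admissibility
  passes to measurable sub-carriers, and every admissible `(W, θ, ξ)` has a normal form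
  `(W', θ, ξ)`, `W' ⊆ W`, with the same current, `θ ≠ 0` a.e. on `W'` and `𝓗^m(W' ∩ K) < ∞` for
  compact `K ⊆ Ω` (`‖θ ξ₁ ∧ ⋯ ∧ ξₘ‖ = |θ| ≥ 1` on `W'` and local integrability);
* on the whole space `Ω = V`: `Current.IsLocallyRectifiable.add_top`,
  `Current.IsRectifiable.add_top/sub_top`, `Current.IsIntegral.add_top/sub_top`,
  `Current.IsIntegralFlatChain.add_top/sub_top` — **`𝓡_m(V)`, `𝐈_m(V)`, `𝓕_m(V)` are additive
  subgroups** [4.1.24], unconditionally (normal form + `IsRectifiableData.add` of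
  `RectifiableAdd.lean`);
* `Current.mass_add_le`, `Current.integralFlatNorm_add_le`, `Current.integralFlatNorm_sub_le` —
  **`𝓕(T₁ + T₂) ≤ 𝓕(T₁) + 𝓕(T₂)`** on `V`; with `integralFlatNorm_neg` and
  `eq_zero_of_integralFlatNorm_eq_zero` (`CurrentsProofs.lean`) the integral flat distance is an
  extended metric on `𝓕_m(V)` ("we metrize 𝓕_{m,K}(U) by … 𝓕_K(T₁ − T₂)", 4.1.24).

Source: H. Federer, *Geometric Measure Theory*, Springer 1969 (`Federer1969`), 3.2.19, 4.1.24,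
4.1.28 (held copy `lit book:federernd-geometric-measure-theory`, PDF pp. 262, 321–326).
-/

noncomputable section

open MeasureTheory MeasureTheory.Measure Set Function Filter Metric Module TopologicalSpace
open scoped ENNReal NNReal Topology

namespace Literature.Geometry.GeometricMeasureTheory

-- Depth 3: `Integrable`-algebra on `Multivector`-valued maps (see `RectifiableAdd.lean`).
set_option maxSynthPendingDepth 3

section TangentSubset

variable {V : Type*} [NormedAddCommGroup V] [NormedSpace ℝ V] [MeasurableSpace V] [BorelSpace V]
  {m : ℕ}

omit [BorelSpace V] in
/-- **Approximate tangent cones are monotone in the measure**: `μ ≤ ν` implies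
`Tan^m(μ, a) ⊆ Tan^m(ν, a)` (more sets `S` have `Θ^{*m}(μ ⌞ Sᶜ, a) = 0`). [cite: Federer1969, 3.2.16] -/
theorem approxTangentCone_mono {μ ν : Measure V} (h : μ ≤ ν) (a : V) :
    approxTangentCone m μ a ⊆ approxTangentCone m ν a := by
  intro v hv
  simp only [approxTangentCone, mem_iInter] at hv ⊢
  intro S hS
  refine hv S (le_antisymm ?_ bot_le)
  exact (upperDensity_mono (Measure.restrict_mono subset_rfl h) a).trans hS.le

variable [FiniteDimensional ℝ V]

/-- **Tangent planes pass to sub-carriers** (Federer 3.2.19 on subsets). Let `W ⊆ V` be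
countably `m`-rectifiable and `ξ` a frame field with
`span ξ(x) = Tan^m(𝓗^m ⌞ W, x)` for `𝓗^m ⌞ W`-a.e. `x`. Then for every measurable `W' ⊆ W`,
`span ξ(x) = Tan^m(𝓗^m ⌞ W', x)` for `𝓗^m ⌞ W'`-a.e. `x`: at a.e. `x = gᵢ(u) ∈ W'` (Lipschitz
parametrisations; Rademacher; Sard for Lipschitz maps, `hausdorffMeasure_image_null_of_fderiv_not_injective`)
the `m`-plane `im Dgᵢ(u)` consists of `(𝓗^m ⌞ W', m)` approximate tangent vectors
(`fderiv_apply_mem_posTangentConeAt_ae`), and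
`im Dgᵢ(u) ⊆ Tan^m(𝓗^m ⌞ W', x) ⊆ Tan^m(𝓗^m ⌞ W, x) = span ξ(x)` with `dim span ξ(x) ≤ m` forces
equality throughout. [cite: Federer1969, 3.2.19 (with 3.2.16, 3.2.3)] -/
theorem ae_span_eq_approxTangentCone_restrict_of_subset {W W' : Set V}
    (hWr : IsCountablyRectifiable m W) (hW'm : MeasurableSet W') (hsub : W' ⊆ W)
    {ξ : V → Fin m → V}
    (hξ : ∀ᵐ x ∂((μHE[m] : Measure V).restrict W),
      ((Submodule.span ℝ (range (ξ x)) : Set V) =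
        approxTangentCone m ((μHE[m] : Measure V).restrict W) x)) :
    ∀ᵐ x ∂((μHE[m] : Measure V).restrict W'),
      ((Submodule.span ℝ (range (ξ x)) : Set V) =
        approxTangentCone m ((μHE[m] : Measure V).restrict W') x) := by
  classical
  set μ : Measure V := (μHE[m] : Measure V).restrict W with hμ
  set μ' : Measure V := (μHE[m] : Measure V).restrict W' with hμ'
  have hμ'μ : μ' ≤ μ := Measure.restrict_mono hsub le_rfl
  have hξ' : ∀ᵐ x ∂μ', ((Submodule.span ℝ (range (ξ x)) : Set V) = approxTangentCone m μ x) :=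
    ae_mono hμ'μ hξ
  -- the normalisation constant `μHE[m] = c • μH[m]`
  set c : ℝ≥0∞ := (addHaarScalarFactor (volume : Measure (EuclideanSpace ℝ (Fin m)))
    (μH[m] : Measure (EuclideanSpace ℝ (Fin m))) : ℝ≥0∞) with hc_def
  have hc0 : c ≠ 0 := by
    rw [hc_def, Ne, ENNReal.coe_eq_zero]
    exact Measure.addHaarScalarFactor_volume_hausdorffMeasure_ne_zero m
  have hctop : c ≠ ⊤ := ENNReal.coe_ne_top
  have hHE : (μHE[m] : Measure V) = c • (μH[m] : Measure V) := by
    rw [Measure.euclideanHausdorffMeasure_def, hc_def, ENNReal.smul_def]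
  have hHE0 : ∀ s : Set V, (μH[m] : Measure V) s = 0 → μ' s = 0 := by
    intro s hs
    rw [hμ']
    refine nonpos_iff_eq_zero.1 ((Measure.le_iff'.1 Measure.restrict_le_self s).trans ?_)
    rw [hHE, Measure.smul_apply, hs, smul_zero]
  -- Lipschitz parametrisations by `ℝᵐ = Fin m → ℝ`
  obtain ⟨f, hf, hcov⟩ := hWr
  let e := EuclideanSpace.equiv (Fin m) ℝ
  let g : ℕ → (Fin m → ℝ) → V := fun i => f i ∘ e.symm
  have hg : ∀ i, ∃ L : ℝ≥0, LipschitzWith L (g i) := fun i => by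
    obtain ⟨K, hK⟩ := hf i
    exact ⟨_, hK.comp (e.symm : (Fin m → ℝ) →L[ℝ] EuclideanSpace ℝ (Fin m)).lipschitz⟩
  have hrange : ∀ i, range (g i) = range (f i) := fun i => by
    ext x
    constructor
    · rintro ⟨u, rfl⟩
      exact ⟨e.symm u, rfl⟩
    · rintro ⟨y, rfl⟩
      exact ⟨e y, by simp [g]⟩
  have hcovμ : ∀ᵐ x ∂μ', x ∈ ⋃ i, range (g i) := by
    have h1 : μ' (⋃ i, range (g i))ᶜ = 0 := by
      rw [hμ', Measure.restrict_apply' hW'm]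
      refine measure_mono_null ?_ hcov
      intro x hx
      refine ⟨hsub hx.2, fun h => hx.1 ?_⟩
      rw [iUnion_congr hrange]
      exact h
    filter_upwards [measure_eq_zero_iff_ae_notMem.1 h1] with x hx
    simpa using hx
  have hW'μ : ∀ᵐ x ∂μ', x ∈ W' := ae_restrict_mem hW'm
  -- reduction to one parametrisation
  suffices H : ∀ i, ∀ᵐ x ∂μ', x ∈ range (g i) → x ∈ W' →
      ((Submodule.span ℝ (range (ξ x)) : Set V) = approxTangentCone m μ x) →
      ((Submodule.span ℝ (range (ξ x)) : Set V) = approxTangentCone m μ' x) by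
    have H' := ae_all_iff.2 H
    filter_upwards [H', hcovμ, hW'μ, hξ'] with x hx hxU hxW hxξ
    obtain ⟨i, hi⟩ := mem_iUnion.1 hxU
    exact hx i hi hxW hxξ
  intro i
  obtain ⟨L, hL⟩ := hg i
  have hjc : Fintype.card (Fin m) = m := Fintype.card_fin m
  have hvol : (μH[m] : Measure (Fin m → ℝ)) = volume := by
    have := hausdorffMeasure_pi_real (ι := Fin m)
    rwa [hjc] at this
  -- the Lebesgue-null exceptional parameter sets
  have h1 : ∀ᵐ u ∂(volume : Measure (Fin m → ℝ)), DifferentiableAt ℝ (g i) u :=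
    hL.ae_differentiableAt
  have h2 : ∀ᵐ u ∂(volume : Measure (Fin m → ℝ)), g i u ∈ W' → DifferentiableAt ℝ (g i) u →
      Injective (fderiv ℝ (g i) u) → ∀ S : Set V,
        upperDensity m (((μH[m] : Measure V).restrict W').restrict Sᶜ) (g i u) = 0 →
        ∀ v, fderiv ℝ (g i) u v ∈ posTangentConeAt S (g i u) := by
    have := fderiv_apply_mem_posTangentConeAt_ae hL hW'm
    rwa [hjc] at this
  set E : Set (Fin m → ℝ) := {u | ¬ (DifferentiableAt ℝ (g i) u ∧
      (g i u ∈ W' → DifferentiableAt ℝ (g i) u → Injective (fderiv ℝ (g i) u) → ∀ S : Set V,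
        upperDensity m (((μH[m] : Measure V).restrict W').restrict Sᶜ) (g i u) = 0 →
        ∀ v, fderiv ℝ (g i) u v ∈ posTangentConeAt S (g i u)))} with hE
  have hE0 : volume E = 0 := by
    have : ∀ᵐ u ∂(volume : Measure (Fin m → ℝ)), DifferentiableAt ℝ (g i) u ∧
        (g i u ∈ W' → DifferentiableAt ℝ (g i) u → Injective (fderiv ℝ (g i) u) → ∀ S : Set V,
          upperDensity m (((μH[m] : Measure V).restrict W').restrict Sᶜ) (g i u) = 0 →
          ∀ v, fderiv ℝ (g i) u v ∈ posTangentConeAt S (g i u)) := by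
      filter_upwards [h1, h2] with u h1 h2 using ⟨h1, h2⟩
    exact ae_iff.1 this
  set Z : Set (Fin m → ℝ) := {u | DifferentiableAt ℝ (g i) u ∧ ¬ Injective (fderiv ℝ (g i) u)}
    with hZ
  have hZ0 : (μH[m] : Measure V) (g i '' Z) = 0 := by
    have := Literature.Analysis.Calculus.hausdorffMeasure_image_null_of_fderiv_not_injective hL
    rwa [hjc] at this
  have hE0' : (μH[m] : Measure V) (g i '' E) = 0 := by
    refine nonpos_iff_eq_zero.1 ((hL.hausdorffMeasure_image_le (Nat.cast_nonneg m) E).trans ?_)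
    rw [hvol, hE0, mul_zero]
  have hbad : ∀ᵐ x ∂μ', x ∉ g i '' (E ∪ Z) := by
    refine measure_eq_zero_iff_ae_notMem.1 (hHE0 _ ?_)
    rw [image_union]
    exact measure_union_null hE0' hZ0
  -- the pointwise argument
  filter_upwards [hbad] with x hx hxr hxW hxξ
  obtain ⟨u, rfl⟩ := hxr
  have huE : u ∉ E := fun h => hx (mem_image_of_mem _ (Or.inl h))
  have huZ : u ∉ Z := fun h => hx (mem_image_of_mem _ (Or.inr h))
  simp only [hE, mem_setOf_eq, not_not] at huE
  obtain ⟨hdiff, hT⟩ := huE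
  have hinj : Injective (fderiv ℝ (g i) u) := by
    by_contra h
    exact huZ ⟨hdiff, h⟩
  set T := fderiv ℝ (g i) u with hT_def
  -- `im Dg(u) ⊆ Tan^m(μ', x) ⊆ Tan^m(μ, x) = span ξ(x)`
  have hTan' : ∀ v, T v ∈ approxTangentCone m μ' (g i u) := by
    intro v
    refine mem_iInter₂.2 fun S hS => hT hxW hdiff hinj S ?_ v
    have e1 : μ'.restrict Sᶜ = c • (((μH[m] : Measure V).restrict W').restrict Sᶜ) := by
      rw [hμ', hHE, Measure.restrict_smul, Measure.restrict_smul]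
    rw [e1, upperDensity_smul _ _ _ hctop, mul_eq_zero] at hS
    exact hS.resolve_left hc0
  have hsub1 : LinearMap.range (T : (Fin m → ℝ) →ₗ[ℝ] V) ≤ Submodule.span ℝ (range (ξ (g i u))) := by
    rintro _ ⟨v, rfl⟩
    change T v ∈ Submodule.span ℝ (range (ξ (g i u)))
    rw [← SetLike.mem_coe, hxξ]
    exact approxTangentCone_mono hμ'μ _ (hTan' v)
  -- equality by dimension
  have heq : LinearMap.range (T : (Fin m → ℝ) →ₗ[ℝ] V) = Submodule.span ℝ (range (ξ (g i u))) := by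
    refine Submodule.eq_of_le_of_finrank_le hsub1 ?_
    rw [LinearMap.finrank_range_of_inj hinj, finrank_fin_fun]
    have := finrank_range_le_card (R := ℝ) (ξ (g i u))
    rw [hjc] at this
    exact this
  -- conclude: `span = im Dg(u) ⊆ Tan^m(μ') ⊆ Tan^m(μ) = span`
  refine Subset.antisymm ?_ ?_
  · intro y hy
    have hy' : y ∈ LinearMap.range (T : (Fin m → ℝ) →ₗ[ℝ] V) := by
      rw [heq]; exact hy
    obtain ⟨v, rfl⟩ := hy'
    exact hTan' v
  · rw [hxξ]
    exact approxTangentCone_mono hμ'μ _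

end TangentSubset


/-! ### Normal form of admissible data; `𝓡_m(V)`, `𝐈_m(V)`, `𝓕_m(V)` are groups -/

section Normalize

variable {V : Type*} [NormedAddCommGroup V] [InnerProductSpace ℝ V] [FiniteDimensional ℝ V]
  [MeasurableSpace V] [BorelSpace V] {Ω : Opens V} {m : ℕ}

/-- **Admissibility passes to measurable sub-carriers**: if `(W, θ, ξ)` are admissible data on
`Ω` and `W' ⊆ W` is measurable then `(W', θ, ξ)` are admissible (the frame condition on `W'` is
`ae_span_eq_approxTangentCone_restrict_of_subset`, Federer 3.2.19). [cite: Federer1969, 4.1.28 (4) with 3.2.19] -/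
theorem IsRectifiableData.subset {W W' : Set V} {θ : V → ℤ} {ξ : V → Fin m → V}
    (h : IsRectifiableData Ω m W θ ξ) (hW'm : MeasurableSet W') (hsub : W' ⊆ W) :
    IsRectifiableData Ω m W' θ ξ := by
  obtain ⟨-, hWΩ, hWr, hint, hae⟩ := h
  have hle : (μHE[m] : Measure V).restrict W' ≤ (μHE[m] : Measure V).restrict W :=
    Measure.restrict_mono hsub le_rfl
  refine ⟨hW'm, hsub.trans hWΩ, hWr.mono hsub, ?_, ?_⟩
  · intro x hx
    obtain ⟨U, hU, hi⟩ := hint x hx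
    exact ⟨U, hU, hi.mono_measure hle⟩
  · have h1 := ae_span_eq_approxTangentCone_restrict_of_subset hWr hW'm hsub
      (hae.mono fun x hx => hx.2)
    filter_upwards [ae_mono hle hae, h1] with x hx hx1
    exact ⟨hx.1, hx1⟩

/-- **Normal form of admissible data.** Admissible data `(W, θ, ξ)` on `Ω` can be replaced by
`(W', θ, ξ)` with `W' ⊆ W`, the same current `[W', θ, ξ] = [W, θ, ξ]`, multiplicity `θ ≠ 0`
almost everywhere on `W'`, and `𝓗^m(W' ∩ K) < ∞` for every compact `K ⊆ Ω` (from the local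
integrability of `θ ξ` and `‖θ ξ₁ ∧ ⋯ ∧ ξₘ‖ = |θ| ≥ 1` on `W'`): take `W' = W ∩ {G ≠ 0}` for a strongly
measurable version `G` of `θ ξ`. [cite: Federer1969, 4.1.28 ((4), "B ⊆ spt T … 𝓗^m ⌞ B summable")] -/
theorem IsRectifiableData.exists_subset_normalized {W : Set V} {θ : V → ℤ} {ξ : V → Fin m → V}
    (h : IsRectifiableData Ω m W θ ξ) :
    ∃ W' : Set V, W' ⊆ W ∧ IsRectifiableData Ω m W' θ ξ ∧
      (currentOfIntegration W' θ ξ : Current Ω m) = currentOfIntegration W θ ξ ∧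
      (∀ᵐ x ∂((μHE[m] : Measure V).restrict W'), θ x ≠ 0) ∧
      ∀ K : Set V, IsCompact K → K ⊆ (Ω : Set V) → (μHE[m] : Measure V) (W' ∩ K) < ⊤ := by
  have hWm : MeasurableSet W := h.1
  have hWΩ : W ⊆ (Ω : Set V) := h.2.1
  have hint := h.2.2.2.1
  have hae := h.2.2.2.2
  -- a strongly measurable version `G` of the density `F = θ ξ`
  have hFa : AEStronglyMeasurable (fun x => (θ x : ℝ) • frameVector (ξ x))
      ((μHE[m] : Measure V).restrict W) := by
    have h1 := hint.aestronglyMeasurable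
    rwa [Measure.restrict_restrict Ω.isOpen.measurableSet, inter_eq_right.2 hWΩ] at h1
  set G : V → Multivector V m := hFa.mk _ with hG_def
  have hG : StronglyMeasurable G := hFa.stronglyMeasurable_mk
  have hFG : (fun x => (θ x : ℝ) • frameVector (ξ x)) =ᵐ[(μHE[m] : Measure V).restrict W] G :=
    hFa.ae_eq_mk
  have hSm : MeasurableSet {x | G x ≠ 0} := hG.measurableSet_support
  set W' : Set V := W ∩ {x | G x ≠ 0} with hW'
  have hW'm : MeasurableSet W' := hWm.inter hSm
  refine ⟨W', inter_subset_left, h.subset hW'm inter_subset_left, ?_, ?_, ?_⟩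
  · -- the currents agree: the densities agree `𝓗^m`-a.e.
    rw [currentOfIntegration_eq_vectorCurrent_indicator hW'm,
      currentOfIntegration_eq_vectorCurrent_indicator hWm]
    refine vectorCurrent_congr_ae ?_
    filter_upwards [(ae_restrict_iff' hWm).1 hFG] with x hx
    by_cases hxW : x ∈ W
    · by_cases hxG : G x ≠ 0
      · rw [indicator_of_mem (show x ∈ W' from ⟨hxW, hxG⟩), indicator_of_mem hxW]
      · rw [indicator_of_notMem (show x ∉ W' from fun h' => hxG h'.2), indicator_of_mem hxW,
          hx hxW, not_not.1 hxG]
    · rw [indicator_of_notMem (show x ∉ W' from fun h' => hxW h'.1), indicator_of_notMem hxW]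
  · -- `θ ≠ 0` a.e. on `W'`
    filter_upwards [ae_restrict_mem hW'm,
      ae_mono (Measure.restrict_mono inter_subset_left le_rfl) hFG] with x hx hFGx
    intro hθ
    apply hx.2
    rw [← hFGx, hθ, Int.cast_zero, zero_smul]
  · -- finiteness on compacts
    intro K hK hKΩ
    have hKm : MeasurableSet K := hK.isClosed.measurableSet
    have hFK : IntegrableOn (fun x => (θ x : ℝ) • frameVector (ξ x)) K
        ((μHE[m] : Measure V).restrict W) := hint.integrableOn_compact_subset hKΩ hK
    -- a.e. on `W`: on `{G ≠ 0}` the density has norm `≥ 1`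
    have hge : ∀ᵐ x ∂(μHE[m] : Measure V).restrict W, x ∈ {x | G x ≠ 0} ∩ K →
        x ∈ {x | (1 : ℝ≥0∞) ≤ ‖(θ x : ℝ) • frameVector (ξ x)‖ₑ} ∩ K := by
      filter_upwards [hFG, hae] with x hFGx hx hxSK
      refine ⟨?_, hxSK.2⟩
      have hθ : θ x ≠ 0 := by
        intro hθ
        apply hxSK.1
        rw [← hFGx, hθ, Int.cast_zero, zero_smul]
      change (1 : ℝ≥0∞) ≤ ‖(θ x : ℝ) • frameVector (ξ x)‖ₑ
      rw [enorm_smul, ← ofReal_norm (frameVector (ξ x)), norm_frameVector_eq_one hx.1,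
        ENNReal.ofReal_one, mul_one, ← ofReal_norm, ← ENNReal.ofReal_one]
      apply ENNReal.ofReal_le_ofReal
      rw [Real.norm_eq_abs, ← Int.cast_abs, ← Int.cast_one, Int.cast_le]
      exact Int.one_le_abs hθ
    have h1 : (μHE[m] : Measure V) (W' ∩ K) =
        ((μHE[m] : Measure V).restrict W) ({x | G x ≠ 0} ∩ K) := by
      rw [Measure.restrict_apply (hSm.inter hKm), hW', inter_assoc, inter_comm W, inter_assoc]
    have h2 : ((μHE[m] : Measure V).restrict W) ({x | G x ≠ 0} ∩ K) ≤
        ((μHE[m] : Measure V).restrict W) ({x | (1 : ℝ≥0∞) ≤ ‖(θ x : ℝ) • frameVector (ξ x)‖ₑ} ∩ K) :=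
      measure_mono_ae hge
    have h3 : ((μHE[m] : Measure V).restrict W) ({x | (1 : ℝ≥0∞) ≤ ‖(θ x : ℝ) • frameVector (ξ x)‖ₑ} ∩ K)
        ≤ ∫⁻ x in K, ‖(θ x : ℝ) • frameVector (ξ x)‖ₑ ∂((μHE[m] : Measure V).restrict W) := by
      rw [← Measure.restrict_apply' hKm]
      have := mul_meas_ge_le_lintegral₀ hFK.1.enorm (1 : ℝ≥0∞)
        (μ := ((μHE[m] : Measure V).restrict W).restrict K)
      rwa [one_mul] at this
    calc (μHE[m] : Measure V) (W' ∩ K)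
        = ((μHE[m] : Measure V).restrict W) ({x | G x ≠ 0} ∩ K) := h1
      _ ≤ _ := h2
      _ ≤ _ := h3
      _ < ⊤ := hFK.2

/-! #### `Ω = V`: unconditional additivity -/

/-- A measure finite on compact sets of the whole space, restricted to the carrier, is locally
finite. [folklore] -/
theorem isLocallyFiniteMeasure_restrict_of_forall_isCompact {W : Set V}
    (h : ∀ K : Set V, IsCompact K → K ⊆ ((⊤ : Opens V) : Set V) → (μHE[m] : Measure V) (W ∩ K) < ⊤) :
    IsLocallyFiniteMeasure (((μHE[m] : Measure V)).restrict W) :=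
  ⟨fun x => ⟨closedBall x 1, closedBall_mem_nhds x one_pos, by
    rw [Measure.restrict_apply measurableSet_closedBall, inter_comm]
    exact h _ (isCompact_closedBall x 1) (by simp)⟩⟩

/-- **`𝓡^{loc}_m(V)` is closed under addition** (unconditionally, on the whole space `Ω = V`):
normalise the data of both summands (`IsRectifiableData.exists_subset_normalized`) and apply
`IsRectifiableData.add`. [cite: Federer1969, 4.1.24 ("𝓡_{m,K}(U) is an additive subgroup") with 4.1.28 (4)] -/
theorem Current.IsLocallyRectifiable.add_top {T₁ T₂ : Current (⊤ : Opens V) m}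
    (h₁ : T₁.IsLocallyRectifiable) (h₂ : T₂.IsLocallyRectifiable) :
    (T₁ + T₂).IsLocallyRectifiable := by
  obtain ⟨W₁, θ₁, ξ₁, hd₁, rfl⟩ := h₁
  obtain ⟨W₂, θ₂, ξ₂, hd₂, rfl⟩ := h₂
  obtain ⟨W₁', -, hd₁', heq₁, -, hfin₁⟩ := hd₁.exists_subset_normalized
  obtain ⟨W₂', -, hd₂', heq₂, -, hfin₂⟩ := hd₂.exists_subset_normalized
  haveI := isLocallyFiniteMeasure_restrict_of_forall_isCompact (m := m) hfin₁
  haveI := isLocallyFiniteMeasure_restrict_of_forall_isCompact (m := m) hfin₂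
  rw [← heq₁, ← heq₂]
  exact isLocallyRectifiable_add_of_isRectifiableData hd₁' hd₂'

/-- **`𝓡_m(V)` is an additive subgroup: closure under addition.** [cite: Federer1969, 4.1.24] -/
theorem Current.IsRectifiable.add_top {T₁ T₂ : Current (⊤ : Opens V) m}
    (h₁ : T₁.IsRectifiable) (h₂ : T₂.IsRectifiable) : (T₁ + T₂).IsRectifiable :=
  ⟨h₁.1.add_top h₂.1, Current.isCompact_support_of_subset _ (h₁.2.union h₂.2) (by simp)
    (Current.support_add_subset _ _)⟩

/-- `𝓡_m(V)` is closed under subtraction. [cite: Federer1969, 4.1.24] -/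
theorem Current.IsRectifiable.sub_top {T₁ T₂ : Current (⊤ : Opens V) m}
    (h₁ : T₁.IsRectifiable) (h₂ : T₂.IsRectifiable) : (T₁ - T₂).IsRectifiable := by
  rw [sub_eq_add_neg]
  exact h₁.add_top h₂.neg

/-- **`𝐈_m(V)` is an additive subgroup: closure under addition.** [cite: Federer1969, 4.1.24] -/
theorem Current.IsIntegral.add_top : ∀ {m : ℕ} {T₁ T₂ : Current (⊤ : Opens V) m},
    T₁.IsIntegral → T₂.IsIntegral → (T₁ + T₂).IsIntegral
  | 0, _, _, h₁, h₂ => Current.IsRectifiable.add_top h₁ h₂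
  | _ + 1, _, _, h₁, h₂ => ⟨Current.IsRectifiable.add_top h₁.1 h₂.1, by
      rw [Current.boundary_add]
      exact Current.IsRectifiable.add_top h₁.2 h₂.2⟩

/-- `𝐈_m(V)` is closed under subtraction. [cite: Federer1969, 4.1.24] -/
theorem Current.IsIntegral.sub_top {T₁ T₂ : Current (⊤ : Opens V) m}
    (h₁ : T₁.IsIntegral) (h₂ : T₂.IsIntegral) : (T₁ - T₂).IsIntegral := by
  rw [sub_eq_add_neg]
  exact h₁.add_top h₂.neg

/-- **`𝓕_m(V)` is an additive subgroup: closure under addition**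
(`(R₁ + ∂S₁) + (R₂ + ∂S₂) = (R₁ + R₂) + ∂(S₁ + S₂)`). [cite: Federer1969, 4.1.24] -/
theorem Current.IsIntegralFlatChain.add_top {T₁ T₂ : Current (⊤ : Opens V) m}
    (h₁ : T₁.IsIntegralFlatChain) (h₂ : T₂.IsIntegralFlatChain) :
    (T₁ + T₂).IsIntegralFlatChain := by
  obtain ⟨R₁, S₁, hR₁, hS₁, rfl⟩ := h₁
  obtain ⟨R₂, S₂, hR₂, hS₂, rfl⟩ := h₂
  exact ⟨R₁ + R₂, S₁ + S₂, hR₁.add_top hR₂, hS₁.add_top hS₂, by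
    rw [Current.boundary_add]; abel⟩

/-- `𝓕_m(V)` is closed under subtraction. [cite: Federer1969, 4.1.24] -/
theorem Current.IsIntegralFlatChain.sub_top {T₁ T₂ : Current (⊤ : Opens V) m}
    (h₁ : T₁.IsIntegralFlatChain) (h₂ : T₂.IsIntegralFlatChain) :
    (T₁ - T₂).IsIntegralFlatChain := by
  rw [sub_eq_add_neg]
  exact h₁.add_top h₂.neg

end Normalize

/-! ### Subadditivity of mass and of the integral flat norm -/

section FlatTriangle

variable {E : Type*} [NormedAddCommGroup E] [NormedSpace ℝ E] {Ω : Opens E} {m : ℕ}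

/-- **`𝐌(S + T) ≤ 𝐌(S) + 𝐌(T)`.** [cite: Federer1969, 4.1.7] -/
theorem Current.mass_add_le (S T : Current Ω m) : (S + T).mass ≤ S.mass + T.mass := by
  refine iSup₂_le fun φ hφ => ?_
  calc ENNReal.ofReal ((S + T) φ) = ENNReal.ofReal (S φ + T φ) := rfl
    _ ≤ ENNReal.ofReal (S φ) + ENNReal.ofReal (T φ) := ENNReal.ofReal_add_le
    _ ≤ S.mass + T.mass := add_le_add (S.ofReal_apply_le_mass hφ) (T.ofReal_apply_le_mass hφ)

end FlatTriangle

section FlatTriangleTop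

variable {V : Type*} [NormedAddCommGroup V] [InnerProductSpace ℝ V] [FiniteDimensional ℝ V]
  [MeasurableSpace V] [BorelSpace V] {m : ℕ}

/-- **The triangle inequality `𝓕(T₁ + T₂) ≤ 𝓕(T₁) + 𝓕(T₂)`** on `V` ("Observing that
𝓕_K(T₁ + T₂) ≤ 𝓕_K(T₁) + 𝓕_K(T₂) … we metrize 𝓕_{m,K}(U)"): decompositions add, by the additivity
of `𝓡_m(V)`, and mass is subadditive. [cite: Federer1969, 4.1.24] -/
theorem Current.integralFlatNorm_add_le (T₁ T₂ : Current (⊤ : Opens V) m) :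
    (T₁ + T₂).integralFlatNorm ≤ T₁.integralFlatNorm + T₂.integralFlatNorm := by
  -- `𝓕(T₁ + T₂) ≤ cost(D₁) + cost(D₂)` for all decompositions
  have key : ∀ (R₁ : Current (⊤ : Opens V) m) (S₁ : Current (⊤ : Opens V) (m + 1)),
      R₁.IsRectifiable ∧ S₁.IsRectifiable ∧ T₁ = R₁ + S₁.boundary →
      ∀ (R₂ : Current (⊤ : Opens V) m) (S₂ : Current (⊤ : Opens V) (m + 1)),
      R₂.IsRectifiable ∧ S₂.IsRectifiable ∧ T₂ = R₂ + S₂.boundary →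
      (T₁ + T₂).integralFlatNorm ≤ (R₁.mass + S₁.mass) + (R₂.mass + S₂.mass) := by
    rintro R₁ S₁ ⟨hR₁, hS₁, rfl⟩ R₂ S₂ ⟨hR₂, hS₂, rfl⟩
    have hdec : R₁ + S₁.boundary + (R₂ + S₂.boundary) = (R₁ + R₂) + (S₁ + S₂).boundary := by
      rw [Current.boundary_add]; abel
    calc (R₁ + S₁.boundary + (R₂ + S₂.boundary)).integralFlatNorm
        ≤ (R₁ + R₂).mass + (S₁ + S₂).mass :=
          iInf_le_of_le (R₁ + R₂) (iInf_le_of_le (S₁ + S₂)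
            (iInf_le_of_le ⟨hR₁.add_top hR₂, hS₁.add_top hS₂, hdec⟩ le_rfl))
      _ ≤ (R₁.mass + R₂.mass) + (S₁.mass + S₂.mass) :=
          add_le_add (Current.mass_add_le _ _) (Current.mass_add_le _ _)
      _ = (R₁.mass + S₁.mass) + (R₂.mass + S₂.mass) := by abel
  -- pass to the infima
  simp only [Current.integralFlatNorm]
  refine ENNReal.le_iInf_add_iInf fun R₁ R₂ => ?_
  refine ENNReal.le_iInf_add_iInf fun S₁ S₂ => ?_
  refine ENNReal.le_iInf_add_iInf fun h₁ h₂ => ?_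
  exact key R₁ S₁ h₁ R₂ S₂ h₂

/-- `𝓕(T₁ - T₃) ≤ 𝓕(T₁ - T₂) + 𝓕(T₂ - T₃)`: the integral flat distance on `V` satisfies the
triangle inequality (with `integralFlatNorm_neg` and `eq_zero_of_integralFlatNorm_eq_zero` of
`CurrentsProofs.lean`, it is an extended metric on the integral flat chains `𝓕_m(V)`).
[cite: Federer1969, 4.1.24] -/
theorem Current.integralFlatNorm_sub_le (T₁ T₂ T₃ : Current (⊤ : Opens V) m) :
    (T₁ - T₃).integralFlatNorm ≤ (T₁ - T₂).integralFlatNorm + (T₂ - T₃).integralFlatNorm := by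
  have : T₁ - T₃ = (T₁ - T₂) + (T₂ - T₃) := by abel
  rw [this]
  exact Current.integralFlatNorm_add_le _ _

end FlatTriangleTop

end Literature.Geometry.GeometricMeasureTheory
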